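import Summits.QuantumFields.YangMills.Theorems.DiagonalMirrorRPRWilsonDiagonalModelReweight
import Summits.QuantumFields.YangMills.Theorems.DiagonalMirrorRPRWilsonDiagonalModelSignedTrace
import Summits.QuantumFields.YangMills.Theorems.DiagonalMirrorRPRWilsonDiagonalModelChainKernel
import Summits.QuantumFields.YangMills.Theorems.DiagonalMirrorRPRWilsonDiagonalModelLiftedOp

/-!
# Crux `DiagonalMirrorRPR` (stmt-QuantumFields-10604), line `sign-twisted-diagonal-trace`, construction F1_diag
# (director-ym O4 WORD 3 (A)), S4e₃: ★★ the spectral trace formula `Σᵢ λᵢ^m = Tr K_u^m = diagCyclicTraceU ρ β m` (`m ≥ 2`)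

Helper for the crux `DiagonalMirrorRPR` of `YangMills` (routes `IsotropyFromPowerCounting`, `MirrorModularBoosts`,
`PencilRigidity`; item stmt-QuantumFields-10604), attached `--supports … --as helper`; it closes nothing by itself.

* `secondCountableTopology_Lp_tMeasure` — `L²(μ̃)` is separable;
* ★★ **`exists_eigen_hasSum_pow_diagCyclicTraceU`** — for `β ≥ 0` and a continuous unitary `ρ` there are a countable index
  set `ι` and reals `λᵢ` (the eigenvalues, with multiplicity and sign, of the compact self-adjoint integral operator of the
  bounded reweighted lifted kernel `𝔟` on `L²(μ̃)` — tree package `PositiveKernelTransferOperator` + `CompactSelfAdjointEigenbasis`)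
  with `Σ λᵢ² < ∞` and `HasSum (λᵢ^{M+2}) (diagCyclicTraceU ρ β (M+2))` for every `M` — i.e. `Σᵢ λᵢ^m = Tr K_u^m` for all
  `m ≥ 2`, where `Tr K_u^m` is the cyclic trace of the Wilson diagonal two-step transfer matrix on the odd torus
  (`= Z_Λ e^{…}` resp. the numerator of diagonal-slab observables by `latticeSchwinger_eq_diagCyclicU`, `…OddTorusChain`).

Chain of equalities: `Σλᵢ^{M+2} = ∫∏𝔟 dμ̃^{⊗(M+2)}` (`hasSum_pow_integral_cyclic_signed`, `…SignedTrace`)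
`= Σ'_k ∫_X ∏𝔞` (`integral_cyclic_bKernel_eq`, `…Reweight`) `= diagCyclicTraceU ρ β (M+2)`
(`diagCyclicTraceU_eq_tsum_integral_natKernel`, `…ChainKernel`; `ZMod (M+2) = Fin (M+2)` definitionally).
NEXT (S5, file `…SpectralData`): `sp/sm/top` and the nine spectral fields of `DiagonalSliceModel` at fixed `k`.
HONEST FRAMING: construction helper; no `def wilsonDiagonalModel`; nothing about D_old ⟨10604⟩, the RP crux of the FOLD
restate, or the summit is proved; the Yang–Mills mass gap is NOT proved here or anywhere in the tree.

References: M. Reed, B. Simon, *Methods of Modern Mathematical Physics I* (1980) Thm. VI.22–23; K. Osterwalder, E. Seiler,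
Ann. Phys. 110 (1978) §2–3 (transfer matrix of lattice gauge theory).
-/

set_option autoImplicit false

noncomputable section

open scoped BigOperators ENNReal
open MeasureTheory Function TopologicalSpace
open Literature.MathematicalPhysics.QuantumLattice Literature.MathematicalPhysics.QuantumFieldTheory
open Summit.QuantumFields.YangMills.Cruxes.DiagonalMirrorRPR.ParityBridgeColdTraces

namespace Summit.QuantumFields.YangMills.Cruxes.DiagonalMirrorRPR.SignTwistedDiagonalTrace.WilsonDiagonal

/-! ## §31 The spectral trace formula `Σᵢ λᵢ^m = Tr K_u^m = diagCyclicTraceU ρ β m` (`m ≥ 2`) -/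

section SpectralTrace

variable {S : ℕ} [NeZero S] {G : Type} [Group G] {Nc : ℕ} (ρ : G →* Matrix (Fin Nc) (Fin Nc) ℂ)
variable [TopologicalSpace G] [IsTopologicalGroup G] [CompactSpace G] [MeasurableSpace G] [BorelSpace G]
  [SecondCountableTopology G]

/-- `L²(μ̃)` is separable (`μ̃` is s-finite on a countably generated space). -/
theorem secondCountableTopology_Lp_tMeasure (β M : ℝ) :
    SecondCountableTopology (Lp ℝ 2 (tMeasure S G Nc β M)) := by
  haveI : IsSeparable (tMeasure S G Nc β M) := by unfold tMeasure halfHaar; infer_instance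
  haveI : Fact ((2 : ENNReal) ≠ ⊤) := ⟨ENNReal.ofNat_ne_top⟩
  infer_instance

/-- ★★ **The spectral trace formula for the Wilson diagonal two-step transfer matrix on the odd torus** (`β ≥ 0`, `ρ` a
continuous unitary representation): there are a countable index set `ι` and real numbers `λᵢ` — the eigenvalues, with
multiplicity and of either sign, of the compact self-adjoint integral operator of the bounded reweighted lifted kernel `𝔟` on
`L²(μ̃)` (equivalently of `𝔞` on `L²(counting ⊗ halfHaar)`, equivalently the non-zero spectrum of `K_u = Ê Ô`) — such that
`Σᵢ λᵢ² < ∞` and, for every `m ≥ 2`,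
`Σᵢ λᵢ^m = diagCyclicTraceU ρ β m = Tr K_u^m` (`HasSum`).
Assembled from `exists_kernelOp` / `isSelfAdjoint_kernelOp` / `isCompactOperator_kernelOp` /
`exists_hilbertBasis_eigenvectors_of_isSelfAdjoint` / `hasSum_lam_sq` (tree, `Literature/Analysis/OperatorTheory`),
`hasSum_pow_integral_cyclic_signed` (`…SignedTrace`), `integral_cyclic_bKernel_eq` (`…Reweight`) and
`diagCyclicTraceU_eq_tsum_integral_natKernel` (`…ChainKernel`).  With `latticeSchwinger_eq_diagCyclicU` /
`integral_wilsonMeasure_eq_diagCyclicU` (`…OddTorusChain`) this is the transfer-matrix representation of the Wilson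
partition function and of diagonal-slab observables on the scheme's odd torus; the `sp`/`sm`/`top` data of
`DiagonalSliceModel` are the positive / negative parts of `(λᵢ)` (S5, OWED) . -/
theorem exists_eigen_hasSum_pow_diagCyclicTraceU (hρ : Continuous ρ) {β : ℝ} (hβ : 0 ≤ β)
    (hρu : ∀ g, ρ g ∈ Matrix.unitaryGroup (Fin Nc) ℂ) :
    ∃ (ι : Type) (_ : Countable ι) (lam : ι → ℝ),
      Summable (fun i => lam i ^ 2) ∧
      ∀ M' : ℕ, HasSum (fun i => lam i ^ (M' + 2)) (diagCyclicTraceU ρ β (M' + 2) (S := S) (G := G)) := by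
  obtain ⟨M, hM⟩ := exists_abs_bondVec_le (S := S) ρ hρ
  haveI := isFiniteMeasure_tMeasure (S := S) (G := G) (Nc := Nc) hβ M
  haveI : SecondCountableTopology (Lp ℝ 2 (tMeasure S G Nc β M)) := secondCountableTopology_Lp_tMeasure β M
  have hK := stronglyMeasurable_bKernel (S := S) ρ hρ β M
  obtain ⟨C, hC⟩ := exists_abs_bKernel_le ρ hρ β hM
  have hsymm := bKernel_symm (S := S) ρ β M
  have hC0 : 0 ≤ C := (norm_nonneg _).trans (hC ((0 : ℕ), fun _ => (1 : G)) ((0 : ℕ), fun _ => (1 : G)))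
  obtain ⟨A, hA⟩ := Literature.Analysis.OperatorTheory.exists_kernelOp (μ := tMeasure S G Nc β M) hK hC
  have hsa := Literature.Analysis.OperatorTheory.isSelfAdjoint_kernelOp hK hC hsymm hA
  have hcpt := Literature.Analysis.OperatorTheory.isCompactOperator_kernelOp hC hC0 hA
  obtain ⟨s, b, κ, hb, hκ⟩ :=
    Literature.Analysis.OperatorTheory.exists_hilbertBasis_eigenvectors_of_isSelfAdjoint hcpt hsa
  have hκ' : ∀ i, A (b i) = κ i • b i := fun i => by simpa using hκ i
  haveI hcount : Countable s := countable_of_orthonormal b.orthonormal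
  refine ⟨s, hcount, κ, (Literature.Analysis.OperatorTheory.hasSum_lam_sq hK hC hA hκ').summable, fun M' => ?_⟩
  have h := hasSum_pow_integral_cyclic_signed hK hC hsymm hA hκ' M'
  rw [integral_cyclic_bKernel_eq ρ hρ hβ hM (M' + 2)] at h
  rw [diagCyclicTraceU_eq_tsum_integral_natKernel ρ hρ hβ hρu (M' + 2)]
  exact h

end SpectralTrace

end Summit.QuantumFields.YangMills.Cruxes.DiagonalMirrorRPR.SignTwistedDiagonalTrace.WilsonDiagonal

end
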